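import Mathlib
import Literature.Probability.LatticeModels.GKSInequalities
import Literature.Probability.LatticeModels.IsingInverseMCertificate
import Literature.Probability.LatticeModels.IsingInverseMCertificateSound
import Literature.Probability.LatticeModels.IsingInverseMCertificateSym
import Literature.Probability.LatticeModels.IsingInverseMCertificateAuto
import Literature.Probability.LatticeModels.IsingInverseMCertificateMulti
import HarnessLib

/-!
# Two-class inverse-M certificates (`IsingPolynomial.checkTwo`, `checkTwoAuto`)

Level two of the multi-class certificate format of `IsingInverseMCertificateMulti`: the edges of a
finite graph `(Fin n, E)` are split into the class-`0` edges (coupling `K₀`) and all the others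
(coupling `K₁`), and a certificate proves `(Σ⁻¹)_{xy} ≤ 0` (`x ≠ y`) for the zero-field Ising
model for ALL `K₀, K₁ ≥ 0` at once — the anisotropic / two-direction instance of the inverse-M
question of Lauritzen–Uhler–Zwiernik (2021, §5). [cite: LauritzenUhlerZwiernik2021, §5]

Bivariate integer polynomials in `v₀ = e^{2K₀} − 1`, `v₁ = e^{2K₁} − 1` are nested coefficient lists
`List (List ℤ)` (outer index = power of `v₁`), with the operations `o2 = zOps.up.up` and the
evaluation `ev2`.  This file supplies: the enumeration `entry2` of the bivariate Edwards–Sokal rows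
`M_{pq}(v₀,v₁) = ∑_ω σ_pσ_q (1+v₀)^{sat₀(ω)} (1+v₁)^{sat₁(ω)}` with its correctness (`ev2_entry2`,
against `esTrue`); the explicit-data checker `checkTwo` (rows re-enumerated, then `checkCoreG o2`)
and the self-computing checker `checkTwoAuto` (rows enumerated; `det M` and the adjugate columns
computed at the integer grid `{0..n·m₀} × {0..n·m₁}` by Montante elimination and recovered by exact
interpolation, first in `v₀` then coefficientwise in `v₁`; nothing about this computation is proved,
`checkCoreG` re-verifies `M·B = d·1`), with their soundness theorems
`inv_entry_nonpos_of_checkTwo` / `inv_entry_nonpos_of_checkTwoAuto`. [cite: FriedliVelenik2017, §3.8.1]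
-/

/-! ### Two coupling classes: bivariate polynomials as `List (List ℤ)` (outer index = power of `v₁`) -/

namespace Literature.Probability.LatticeModels

namespace IsingPolynomial

open Finset Matrix

/-- Operations on univariate integer polynomials `List ℤ`. [folklore] -/
def o1 : LOps (List ℤ) := zOps.up

/-- Operations on bivariate integer polynomials `List (List ℤ)`. [folklore] -/
def o2 : LOps (List (List ℤ)) := o1.up

/-- Evaluation of `List ℤ` at `v₀`. [folklore] -/
def ev1 (v0 : ℝ) (p : List ℤ) : ℝ := geval (fun z : ℤ => (z : ℝ)) p v0

/-- Evaluation of `List (List ℤ)` at `(v₀, v₁)`. [folklore] -/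
def ev2 (v0 v1 : ℝ) (P : List (List ℤ)) : ℝ := geval (ev1 v0) P v1

/-- `ev1` is sound for `o1` at `v₀ ≥ 0`. [folklore] -/
theorem sem1 {v0 : ℝ} (h0 : 0 ≤ v0) : o1.Sem (ev1 v0) := LOps.up_sem zOps_sem v0 h0

/-- `ev2` is sound for `o2` on the nonnegative quadrant. [folklore] -/
theorem sem2 {v0 v1 : ℝ} (h0 : 0 ≤ v0) (h1 : 0 ≤ v1) : o2.Sem (ev2 v0 v1) :=
  LOps.up_sem (sem1 h0) v1 h1

/-- `ev1` is `leval`. [folklore] -/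
theorem ev1_eq_leval (v0 : ℝ) (p : List ℤ) : ev1 v0 p = leval p v0 := geval_int_eq_leval p v0

/-! ### Enumeration of the bivariate Edwards–Sokal rows -/

/-- (`#` satisfied class-`0` edges, `#` satisfied other edges) of the configuration coded by `k`
(edge `j` of the list has class `cls[j]`, default `0`). [folklore] -/
def satPair (k : ℕ) : List (ℕ × ℕ) → List ℕ → ℕ × ℕ
  | [], _ => (0, 0)
  | e :: es, cls =>
    let r := satPair k es cls.tail
    if bit k e.1 = bit k e.2 then (if cls.headD 0 = 0 then (r.1 + 1, r.2) else (r.1, r.2 + 1))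
    else r

/-- Nested coefficients of `a · (1+v₀)^{s₀} (1+v₁)^{s₁}`. [folklore] -/
def binom2 (a : ℤ) (s0 s1 : ℕ) : List (List ℤ) :=
  (onePlusPow s1).map fun b => lsmul (a * b) (onePlusPow s0)

/-- The contribution of configuration `k` to `M_{pq}(v₀, v₁)`. [folklore] -/
def term2 (E : List (ℕ × ℕ)) (cls : List ℕ) (p q k : ℕ) : List (List ℤ) :=
  binom2 (spinOf k p * spinOf k q) (satPair k E cls).1 (satPair k E cls).2

/-- `∑_{j < 2^d} f (2^d k + j)`, binary splitting. [folklore] -/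
def cfgSum2 (f : ℕ → List (List ℤ)) : ℕ → ℕ → List (List ℤ)
  | 0, k => f k
  | d + 1, k => gadd o1 (cfgSum2 f d (2 * k)) (cfgSum2 f d (2 * k + 1))

/-- The bivariate Edwards–Sokal entry `M_{pq}(v₀,v₁) = ∑_ω σ_pσ_q (1+v₀)^{sat₀(ω)} (1+v₁)^{sat₁(ω)}`. [folklore] -/
def entry2 (n : ℕ) (E : List (ℕ × ℕ)) (cls : List ℕ) (p q : ℕ) : List (List ℤ) :=
  cfgSum2 (term2 E cls p q) n 0

/-- The two-class checker with explicit data: the rows `rows` of `Mtab` are re-derived by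
enumeration, then the generic core checker at level two. [folklore] -/
def checkTwo (n : ℕ) (E : List (ℕ × ℕ)) (cls : List ℕ) (Mtab : List (List (List (List ℤ))))
    (Bcls : List (List (List ℤ))) (Bidx : List (List ℕ)) (d : List (List ℤ)) (rows : List ℕ)
    (gens : List (List ℕ × List ℕ)) : Bool :=
  (rows.all fun p => (List.range n).all fun q => o2.eqv (getPolyG o2 Mtab p q) (entry2 n E cls p q)) &&
  checkCoreG o2 n E cls Mtab Bcls Bidx d rows gens

section Semantics

variable {n : ℕ}

/-- `geval` of a mapped integer list whose images evaluate to `C·b`. [folklore] -/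
theorem geval_map_const_mul {β : Type} (ev : β → ℝ) (g : ℤ → β) (C : ℝ)
    (hg : ∀ b, ev (g b) = C * (b : ℝ)) (l : List ℤ) (x : ℝ) :
    geval ev (l.map g) x = C * leval l x := by
  induction l with
  | nil => simp [geval]
  | cons b bs ih => simp only [List.map_cons, geval, leval_cons, ih, hg]; ring

/-- `binom2 a s₀ s₁` evaluates to `a (1+v₀)^{s₀} (1+v₁)^{s₁}`. [folklore] -/
theorem ev2_binom2 (v0 v1 : ℝ) (a : ℤ) (s0 s1 : ℕ) :
    ev2 v0 v1 (binom2 a s0 s1) = (a : ℝ) * (1 + v0) ^ s0 * (1 + v1) ^ s1 := by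
  rw [ev2, binom2, geval_map_const_mul (ev1 v0) _ ((a : ℝ) * (1 + v0) ^ s0) (fun b => by
    rw [ev1_eq_leval, leval_lsmul, leval_onePlusPow, Int.cast_mul]; ring), leval_onePlusPow]

/-- `cfgSum2` evaluates to the sum of the evaluations (needs `v₀ ≥ 0` only because the generic
additivity lemma is stated for sound evaluations). [folklore] -/
theorem ev2_cfgSum2 {v0 : ℝ} (h0 : 0 ≤ v0) (v1 : ℝ) (f : ℕ → List (List ℤ)) (d k : ℕ) :
    ev2 v0 v1 (cfgSum2 f d k) = ∑ j ∈ Finset.range (2 ^ d), ev2 v0 v1 (f (2 ^ d * k + j)) := by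
  induction d generalizing k with
  | zero => simp [cfgSum2]
  | succ d ih =>
    rw [cfgSum2, ev2, geval_gadd (sem1 h0), ← ev2, ← ev2, ih, ih]
    have h2 : 2 ^ (d + 1) = 2 ^ d + 2 ^ d := by ring
    rw [h2, Finset.sum_range_add]
    congr 1
    · exact Finset.sum_congr rfl fun j _ => by
        rw [show 2 ^ d * (2 * k) + j = (2 ^ d + 2 ^ d) * k + j by ring]
    · exact Finset.sum_congr rfl fun j _ => by
        rw [show 2 ^ d * (2 * k + 1) + j = (2 ^ d + 2 ^ d) * k + (2 ^ d + j) by ring]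

/-- (`#` satisfied class-`0` edges, `#` satisfied other edges) of a genuine configuration. [folklore] -/
def satPairR (ω : SpinConfig (Fin n)) : List (ℕ × ℕ) → List ℕ → ℕ × ℕ
  | [], _ => (0, 0)
  | e :: es, cls =>
    let r := satPairR ω es cls.tail
    if spinN ω e.1 = spinN ω e.2 then (if cls.headD 0 = 0 then (r.1 + 1, r.2) else (r.1, r.2 + 1))
    else r

/-- On a decoded configuration, agreement of spins is agreement of bits. [folklore] -/
theorem spinN_eq_iff_bit (k : Fin (2 ^ n)) {a b : ℕ} (ha : a < n) (hb : b < n) :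
    spinN ((cfgEquiv n).symm k) a = spinN ((cfgEquiv n).symm k) b ↔ bit k a = bit k b := by
  rw [spinN_cfgEquiv_symm k ha, spinN_cfgEquiv_symm k hb, spinOf, spinOf]
  have h1 : bit k a < 2 := Nat.mod_lt _ (by norm_num)
  have h2 : bit k b < 2 := Nat.mod_lt _ (by norm_num)
  have key : ∀ x, x < 2 → ∀ y, y < 2 →
      (((if x = 1 then (1 : ℤ) else -1) = if y = 1 then (1 : ℤ) else -1) ↔ x = y) := by decide
  exact key _ h1 _ h2

/-- On a decoded configuration the two pair counts agree. [folklore] -/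
theorem satPairR_cfgEquiv_symm (k : Fin (2 ^ n)) :
    ∀ (l : List (ℕ × ℕ)) (cls : List ℕ), (∀ e ∈ l, e.1 < n ∧ e.2 < n) →
      satPairR ((cfgEquiv n).symm k) l cls = satPair k l cls := by
  intro l
  induction l with
  | nil => intro cls _; rfl
  | cons e es ih =>
    intro cls hl
    have he := hl e (by simp)
    have ih' := ih cls.tail fun e' he' => hl e' (by simp [he'])
    simp only [satPairR, satPair, ih']
    by_cases h : bit k e.1 = bit k e.2
    · rw [if_pos ((spinN_eq_iff_bit k he.1 he.2).2 h), if_pos h]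
    · rw [if_neg (mt (spinN_eq_iff_bit k he.1 he.2).1 h), if_neg h]

/-- `l.getD (i+1) d = l.tail.getD i d`. [folklore] -/
theorem getD_succ_eq_tail (l : List ℕ) (i d : ℕ) : l.getD (i + 1) d = l.tail.getD i d := by
  cases l <;> simp

/-- `l.getD 0 d = l.headD d`. [folklore] -/
theorem getD_zero_eq_headD (l : List ℕ) (d : ℕ) : l.getD 0 d = l.headD d := by
  cases l <;> simp

/-- The product of the two-class Edwards–Sokal factors along an edge list (indexed by `range`) is
`(1+v₀)^{sat₀} (1+v₁)^{sat₁}`. [folklore] -/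
theorem prod_range_factor2_eq (ω : SpinConfig (Fin n)) (v0 v1 : ℝ) :
    ∀ (l : List (ℕ × ℕ)) (cls : List ℕ),
      ∏ i ∈ Finset.range l.length, (if spinN ω (l.getD i (0, 0)).1 = spinN ω (l.getD i (0, 0)).2
        then 1 + (if cls.getD i 0 = 0 then v0 else v1) else (1 : ℝ)) =
      (1 + v0) ^ (satPairR ω l cls).1 * (1 + v1) ^ (satPairR ω l cls).2 := by
  intro l
  induction l with
  | nil => intro cls; simp [satPairR]
  | cons e es ih =>
    intro cls
    rw [List.length_cons, Finset.prod_range_succ']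
    simp only [List.getD_cons_succ, List.getD_cons_zero, getD_succ_eq_tail, getD_zero_eq_headD]
    rw [ih cls.tail]
    simp only [satPairR]
    split_ifs <;> ring

/-- The same product indexed by `Fin E.length`, as in `esTrue`. [folklore] -/
theorem prod_factor2_eq (ω : SpinConfig (Fin n)) (v0 v1 : ℝ) (l : List (ℕ × ℕ)) (cls : List ℕ) :
    ∏ i : Fin l.length, (if spinN ω (l[i.1]).1 = spinN ω (l[i.1]).2
        then 1 + (if cls.getD i.1 0 = 0 then v0 else v1) else (1 : ℝ)) =
      (1 + v0) ^ (satPairR ω l cls).1 * (1 + v1) ^ (satPairR ω l cls).2 := by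
  rw [← prod_range_factor2_eq ω v0 v1 l cls, ← Fin.prod_univ_eq_prod_range]
  refine Finset.prod_congr rfl fun i _ => ?_
  rw [List.getD_eq_getElem _ _ i.2]

/-- Evaluation of one configuration term. [folklore] -/
theorem ev2_term2 (v0 v1 : ℝ) (E : List (ℕ × ℕ)) (cls : List ℕ) (p q k : ℕ) :
    ev2 v0 v1 (term2 E cls p q k) =
      ((spinOf k p * spinOf k q : ℤ) : ℝ) * (1 + v0) ^ (satPair k E cls).1 *
        (1 + v1) ^ (satPair k E cls).2 := by
  rw [term2, ev2_binom2]

/-- **The bivariate enumeration is correct**: `entry2` evaluates to the true two-class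
Edwards–Sokal entry (class `0` ↦ `v₀`, every other class ↦ `v₁`). [folklore] -/
theorem ev2_entry2 {E : List (ℕ × ℕ)} (hE : edgesOK n E = true) (cls : List ℕ) {v0 : ℝ}
    (h0 : 0 ≤ v0) (v1 : ℝ) (p q : Fin n) :
    ev2 v0 v1 (entry2 n E cls p q) = esTrue n E cls (fun c => if c = 0 then v0 else v1) p q := by
  simp only [esTrue, prod_factor2_eq _ v0 v1 E cls]
  rw [← Equiv.sum_comp (cfgEquiv n).symm, entry2, ev2_cfgSum2 h0]
  simp only [mul_zero, zero_add]
  rw [← Fin.sum_univ_eq_sum_range (fun k => ev2 v0 v1 (term2 E cls p q k)) (2 ^ n)]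
  refine Finset.sum_congr rfl fun k _ => ?_
  rw [ev2_term2, satPairR_cfgEquiv_symm k E cls (edgesOK_mem hE), spinAt, spinAt,
    coe_cfgEquiv_symm, coe_cfgEquiv_symm]
  push_cast
  ring

end Semantics

/-! ### Soundness of the two-class checkers -/

section Sound2

variable {n : ℕ} {E : List (ℕ × ℕ)} {cls : List ℕ}

/-- `checkCoreG` checks the edge list. [folklore] -/
theorem edgesOK_of_checkCoreG {α : Type} {o : LOps α} {Mtab : List (List α)} {Bcls : List α}
    {Bidx : List (List ℕ)} {d : α} {rows : List ℕ} {gens : List (List ℕ × List ℕ)}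
    (h : checkCoreG o n E cls Mtab Bcls Bidx d rows gens = true) : edgesOK n E = true := by
  simp only [checkCoreG, Bool.and_eq_true] at h
  exact h.1.1.1.1.1.1

/-- **Soundness at level two, core form**: `checkCoreG o2` on a table whose rows `rows` evaluate like
`entry2` proves `(Σ⁻¹)_{xy} ≤ 0` for every `K₀, K₁ ≥ 0` (class `0` edges carry `K₀`, all other
edges `K₁`). [folklore] -/
theorem inv_entry_nonpos_of_core2 {Mtab : List (List (List (List ℤ)))} {Bcls : List (List (List ℤ))}
    {Bidx : List (List ℕ)} {d : List (List ℤ)} {rows : List ℕ} {gens : List (List ℕ × List ℕ)}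
    (hcore : checkCoreG o2 n E cls Mtab Bcls Bidx d rows gens = true)
    (hM : ∀ p ∈ rows, p < n → ∀ q < n, ∀ v0 v1 : ℝ, 0 ≤ v0 →
      ev2 v0 v1 (getPolyG o2 Mtab p q) = ev2 v0 v1 (entry2 n E cls p q))
    (K0 K1 : ℝ) (hK0 : 0 ≤ K0) (hK1 : 0 ≤ K1) (x y : Fin n) (hxy : x ≠ y) :
    (Matrix.of fun p q : Fin n => gksExpect Finset.univ
        (fun i : Fin E.length => if cls.getD i.1 0 = 0 then K0 else K1) (edgeSet n E)
        (fun ω => spinAt p ω * spinAt q ω))⁻¹ x y ≤ 0 := by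
  set v0 : ℝ := Real.exp (2 * K0) - 1 with hv0_def
  set v1 : ℝ := Real.exp (2 * K1) - 1 with hv1_def
  have hv0 : 0 ≤ v0 := sub_nonneg.2 (Real.one_le_exp (by linarith))
  have hv1 : 0 ≤ v1 := sub_nonneg.2 (Real.one_le_exp (by linarith))
  have hE := edgesOK_of_checkCoreG hcore
  have hfun : (fun c : ℕ => Real.exp (2 * (if c = 0 then K0 else K1)) - 1) =
      fun c => if c = 0 then v0 else v1 := by
    funext c
    split_ifs <;> rfl
  have key := inv_entry_nonpos_of_checkCoreG (sem2 hv0 hv1) hcore (fun c => if c = 0 then K0 else K1)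
    (fun p hp hpn q => by
      rw [hfun, hM p hp hpn q q.2 v0 v1 hv0]
      exact ev2_entry2 hE cls hv0 v1 ⟨p, hpn⟩ q) x y hxy
  exact key

/-- **Soundness of `checkTwo`.** [folklore] -/
theorem inv_entry_nonpos_of_checkTwo {Mtab : List (List (List (List ℤ)))} {Bcls : List (List (List ℤ))}
    {Bidx : List (List ℕ)} {d : List (List ℤ)} {rows : List ℕ} {gens : List (List ℕ × List ℕ)}
    (h : checkTwo n E cls Mtab Bcls Bidx d rows gens = true)
    (K0 K1 : ℝ) (hK0 : 0 ≤ K0) (hK1 : 0 ≤ K1) (x y : Fin n) (hxy : x ≠ y) :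
    (Matrix.of fun p q : Fin n => gksExpect Finset.univ
        (fun i : Fin E.length => if cls.getD i.1 0 = 0 then K0 else K1) (edgeSet n E)
        (fun ω => spinAt p ω * spinAt q ω))⁻¹ x y ≤ 0 := by
  simp only [checkTwo, Bool.and_eq_true] at h
  obtain ⟨hM, hcore⟩ := h
  refine inv_entry_nonpos_of_core2 hcore (fun p hp _ q hq v0 v1 hv0 => ?_) K0 K1 hK0 hK1 x y hxy
  exact geval_eq_of_gEq (sem1 hv0) v1 (all_range (List.all_eq_true.1 hM p hp) hq)

end Sound2

/-! ### Self-computed two-class certificates (for `native_decide`) -/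

/-- Evaluate a bivariate integer polynomial at an integer point. [folklore] -/
def leval2Int (f : List (List ℤ)) (x0 x1 : ℤ) : ℤ := leval (f.map fun c => leval c x0) x1

/-- Drop trailing empty coefficient lists. [folklore] -/
def otrim (P : List (List ℤ)) : List (List ℤ) := (P.reverse.dropWhile fun l => l.isEmpty).reverse

/-- Exact bivariate interpolation on the grid `{0..N₀} × {0..N₁}`: from the values `vals[x₁][x₀]` of
an integer polynomial of degree `≤ N₀` in `v₀` and `≤ N₁` in `v₁`, its nested coefficients (outer
index = power of `v₁`); first in `v₀` for each `x₁`, then coefficientwise in `v₁`. [folklore] -/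
def interp2 (vals : List (List ℤ)) : List (List ℤ) :=
  let P := vals.map interpolate0N
  let la := P.foldl (fun m l => max m l.length) 0
  let Q := (List.range la).map fun a => interpolate0N (P.map fun l => l.getD a 0)
  let lb := Q.foldl (fun m l => max m l.length) 0
  otrim ((List.range lb).map fun b => ltrim ((List.range la).map fun a => (Q.getD a []).getD b 0))

/-- The number of class-`0` edges among the first `m`. [folklore] -/
def numClass0 (cls : List ℕ) (m : ℕ) : ℕ := ((List.range m).filter fun i => cls.getD i 0 = 0).length

/-- Compute the rest of the level-two certificate `(Bcls, Bidx, d)` from the row table and the coset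
data (as `autoCert`, on the grid `{0..n·m₀} × {0..n·m₁}`). Nothing about it is proved. [folklore] -/
def autoCert2 (n : ℕ) (E : List (ℕ × ℕ)) (cls : List ℕ) (rows : List ℕ) (coset : List (ℕ × List ℕ))
    (Mtab : List (List (List (List ℤ)))) :
    List (List (List ℤ)) × List (List ℕ) × List (List ℤ) :=
  let m0 := numClass0 cls E.length
  let N0 := n * m0
  let N1 := n * (E.length - m0)
  let rowPolys : List (List (List (List ℤ))) := rows.map fun r => Mtab.getD r []
  let Mpoly : List (List (List (List ℤ))) := (List.range n).map fun p =>
    let c := coset.getD p (0, [])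
    (List.range n).map fun q => (rowPolys.getD c.1 []).getD (permAt c.2 q) []
  let evals : List (List (ℤ × List (List ℤ))) := (List.range (N1 + 1)).map fun x1 =>
    (List.range (N0 + 1)).map fun x0 =>
      detAdjCols n (Mpoly.map fun row => row.map fun f => leval2Int f x0 x1) rows
  let d := interp2 (evals.map fun col => col.map fun e => e.1)
  let Bcls : List (List (List ℤ)) := (List.range rows.length).flatMap fun j =>
    (List.range n).map fun i => interp2 (evals.map fun col => col.map fun e => (e.2.getD j []).getD i 0)
  let Bidx : List (List ℕ) := (List.range n).map fun p =>
    let c := coset.getD p (0, [])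
    (List.range n).map fun q => c.1 * n + permAt c.2 q
  (Bcls, Bidx, d)

/-- The table of rows `rows` of the bivariate Edwards–Sokal matrix (other rows empty). [folklore] -/
def rowTable2 (n : ℕ) (E : List (ℕ × ℕ)) (cls : List ℕ) (rows : List ℕ) : List (List (List (List ℤ))) :=
  (List.range n).map fun p => if p ∈ rows then (List.range n).map fun q => entry2 n E cls p q else []

/-- **The self-computing two-class checker**: enumerate the rows, compute the certificate, run
`checkCoreG o2`. [folklore] -/
def checkTwoAuto (n : ℕ) (E : List (ℕ × ℕ)) (cls : List ℕ) (rows : List ℕ)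
    (gens : List (List ℕ × List ℕ)) (coset : List (ℕ × List ℕ)) : Bool :=
  let Mtab := rowTable2 n E cls rows
  let c := autoCert2 n E cls rows coset Mtab
  checkCoreG o2 n E cls Mtab c.1 c.2.1 c.2.2 rows gens

/-- The rows of `rowTable2` are the enumerated rows. [folklore] -/
theorem getPolyG_rowTable2 {n : ℕ} {E : List (ℕ × ℕ)} {cls : List ℕ} {rows : List ℕ} {p q : ℕ}
    (hp : p ∈ rows) (hpn : p < n) (hq : q < n) :
    getPolyG o2 (rowTable2 n E cls rows) p q = entry2 n E cls p q := by
  have h1 : (rowTable2 n E cls rows).getD p [] = (List.range n).map fun q => entry2 n E cls p q := by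
    rw [rowTable2, List.getD_eq_getElem _ _ (by simpa using hpn)]
    simp [hp]
  rw [getPolyG, h1, List.getD_eq_getElem _ _ (by simpa using hq)]
  simp

/-- **Soundness of `checkTwoAuto`.** For the zero-field Ising model on `(Fin n, E)` with coupling
`K₀ ≥ 0` on the class-`0` edges and `K₁ ≥ 0` on all other edges, every off-diagonal entry of the
inverse of the spin second-moment matrix is `≤ 0`. [folklore] -/
theorem inv_entry_nonpos_of_checkTwoAuto {n : ℕ} {E : List (ℕ × ℕ)} {cls : List ℕ} {rows : List ℕ}
    {gens : List (List ℕ × List ℕ)} {coset : List (ℕ × List ℕ)}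
    (h : checkTwoAuto n E cls rows gens coset = true) (K0 K1 : ℝ) (hK0 : 0 ≤ K0) (hK1 : 0 ≤ K1)
    (x y : Fin n) (hxy : x ≠ y) :
    (Matrix.of fun p q : Fin n => gksExpect Finset.univ
        (fun i : Fin E.length => if cls.getD i.1 0 = 0 then K0 else K1) (edgeSet n E)
        (fun ω => spinAt p ω * spinAt q ω))⁻¹ x y ≤ 0 :=
  inv_entry_nonpos_of_core2 (Mtab := rowTable2 n E cls rows)
    (Bcls := (autoCert2 n E cls rows coset (rowTable2 n E cls rows)).1)
    (Bidx := (autoCert2 n E cls rows coset (rowTable2 n E cls rows)).2.1)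
    (d := (autoCert2 n E cls rows coset (rowTable2 n E cls rows)).2.2) h
    (fun _ hp hpn _ hq v0 v1 _ => by rw [getPolyG_rowTable2 hp hpn hq]) K0 K1 hK0 hK1 x y hxy


end IsingPolynomial

end Literature.Probability.LatticeModels
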